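import Summits.ValiantsHypothesis.ValiantsHypothesis.Theorems.KPlusLogSqLawTropicalBSplitDefs

/-!
# Route «KPlusLogSqLaw», crux `TropicalB` (stmt-ValiantsHypothesis-19771) — CLASS-REVERSAL DUALITY of the unsigned tropical row:
# `DesignRowD (D − d ∘ rev) (v ∘ rev) (ε ∘ rev) B ↔ DesignRowD d v ε B`

HONEST FRAMING.  Structure helper toward the crux `Summit.ValiantsHypothesis.ValiantsHypothesis.Theses.KPlusLogSqLaw.TropicalB` (item
`stmt-ValiantsHypothesis-19771`, route `KPlusLogSqLaw`; cell `pub-symmetroid`, seat val-sym-trop-p5 g12, 2026-08-28; `--supports … --as helper`).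
An elementary symmetry valid for every format; it bounds nothing by itself and bears on neither `TropicalB` in its window, `WeakLifting`, the
doors, `MatrixDescartes` (stmt-ValiantsHypothesis-18050) nor VP ≠ VNP.  Used by `…ThreeFourOrderTypeLawMirror` to transport the `(3,4)`
order-type laws to the mirror-image exponent regions.

THE DUALITY.  Reverse the class order and reflect the exponents: `d′ l = D − d (rev l)` (`D ≥ max d`), `v′ a b l = v a b (rev l)`,
`ε′ a b l = ε a b (rev l)`.  The term `(σ, λ)` of the reflected design has the weight of `(σ, rev ∘ λ)` in the original design at the OPPOSITE
slope, up to the common shift `θ·m·D` (`tropWeight_classRev`), and the same sign (`termSign_classRev`); so unique optima correspond at `θ ↔ −θ`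
(`isDominant_classRev_iff`) and a dominant chain of one design, read backwards, is a dominant chain of the other: the unsigned row bound
`DesignRowD` is invariant (`designRowD_classRev`, `designRowD_of_classRev`).  [folklore: the symmetry `x ↦ 1/x` of a Laurent pencil; this cell]
-/

set_option linter.dupNamespace false
set_option autoImplicit false

namespace Summit.ValiantsHypothesis.ValiantsHypothesis.Theorems.KPlusLogSqLaw

namespace ClassReversal

open Summit.ValiantsHypothesis.ValiantsHypothesis.Theorems.MatrixDescartes.Negative
open Finset

variable {m K : ℕ} (d : Fin K → ℕ) (D : ℕ) (v ε : Fin m → Fin m → Fin K → ℤ)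

/-- the reflected term: same permutation, classes reversed. -/
def revTerm (q : Equiv.Perm (Fin m) × (Fin m → Fin K)) : Equiv.Perm (Fin m) × (Fin m → Fin K) := (q.1, fun b => Fin.rev (q.2 b))

/-- `revTerm` is an involution. -/
theorem revTerm_revTerm (q : Equiv.Perm (Fin m) × (Fin m → Fin K)) : revTerm (revTerm q) = q := by
  unfold revTerm
  ext1
  · rfl
  · funext b; simp

/-- `revTerm` is injective. -/
theorem revTerm_injective : Function.Injective (revTerm (m := m) (K := K)) := fun p q h => by
  rw [← revTerm_revTerm p, ← revTerm_revTerm q, h]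

/-- **sign**: the reflected design gives the reflected term the sign of the original term. -/
theorem termSign_classRev (q : Equiv.Perm (Fin m) × (Fin m → Fin K)) :
    termSign (fun a b l => ε a b (Fin.rev l)) q = termSign ε (revTerm q) := by
  unfold termSign revTerm
  rfl

/-- **weight**: `wt′_θ(q) = θ·m·D + wt_{−θ}(revTerm q)` when `d ≤ D`. -/
theorem tropWeight_classRev (hD : ∀ l, d l ≤ D) (θ : ℤ) (q : Equiv.Perm (Fin m) × (Fin m → Fin K)) :
    tropWeight (fun l => D - d (Fin.rev l)) (fun a b l => v a b (Fin.rev l)) θ q =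
      θ * (m * (D : ℤ)) + tropWeight d v (-θ) (revTerm q) := by
  unfold tropWeight revTerm
  simp only
  have h : ∀ b : Fin m, (((D - d (Fin.rev (q.2 b)) : ℕ) : ℤ)) = (D : ℤ) - (d (Fin.rev (q.2 b)) : ℤ) := fun b => by
    rw [Nat.cast_sub (hD _)]
  simp_rw [h]
  rw [Finset.sum_sub_distrib, Finset.sum_const, Finset.card_univ, Fintype.card_fin]
  simp only [nsmul_eq_mul]
  ring

/-- **dominance**: `q` is the unique optimum of the reflected design at `θ` iff `revTerm q` is the unique optimum of the original design at `−θ`. -/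
theorem isDominant_classRev_iff (hD : ∀ l, d l ≤ D) (θ : ℤ) (q : Equiv.Perm (Fin m) × (Fin m → Fin K)) :
    IsDominant (fun l => D - d (Fin.rev l)) (fun a b l => v a b (Fin.rev l)) (fun a b l => ε a b (Fin.rev l)) θ q ↔
      IsDominant d v ε (-θ) (revTerm q) := by
  unfold IsDominant
  rw [termSign_classRev]
  refine and_congr Iff.rfl ⟨fun h p' hne hp' => ?_, fun h p' hne hp' => ?_⟩
  · have hne' : revTerm p' ≠ q := fun e => hne (by rw [← e, revTerm_revTerm])
    have hp'' : termSign (fun a b l => ε a b (Fin.rev l)) (revTerm p') ≠ 0 := by rwa [termSign_classRev, revTerm_revTerm]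
    have := h (revTerm p') hne' hp''
    rw [tropWeight_classRev d D v hD, tropWeight_classRev d D v hD, revTerm_revTerm] at this
    linarith
  · have hne' : revTerm p' ≠ revTerm q := fun e => hne (revTerm_injective e)
    have hp'' : termSign ε (revTerm p') ≠ 0 := by rwa [← termSign_classRev]
    have := h (revTerm p') hne' hp''
    rw [tropWeight_classRev d D v hD, tropWeight_classRev d D v hD]
    linarith

/-- **CLASS-REVERSAL DUALITY (one direction)**: the unsigned row bound of a design transfers to its reflection. -/
theorem designRowD_classRev (hD : ∀ l, d l ≤ D) (B : ℕ) (h : DesignRowD d v ε B) :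
    DesignRowD (fun l => D - d (Fin.rev l)) (fun a b l => v a b (Fin.rev l)) (fun a b l => ε a b (Fin.rev l)) B := by
  intro n θ p hθ hdom hne
  -- read the chain backwards at the opposite slopes
  refine h n (fun j => -θ (Fin.rev j)) (fun j => revTerm (p (Fin.rev j))) ?_ ?_ ?_
  · intro i j hij
    have := hθ (Fin.rev_lt_rev.mpr hij)
    simp only [neg_lt_neg_iff]
    exact this
  · intro j
    exact (isDominant_classRev_iff d D v ε hD _ _).mp (hdom _)
  · intro k hk
    have e1 : Fin.rev k.castSucc = (Fin.rev k).succ := by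
      apply Fin.ext; simp [Fin.rev, Fin.castSucc, Fin.succ]; omega
    have e2 : Fin.rev k.succ = (Fin.rev k).castSucc := by
      apply Fin.ext; simp [Fin.rev, Fin.castSucc, Fin.succ]
    rw [e1, e2] at hk
    exact hne (Fin.rev k) (revTerm_injective hk).symm

/-- **CLASS-REVERSAL DUALITY (converse direction, the one used to transport laws)**: if the reflected design obeys the bound, so does the
original. -/
theorem designRowD_of_classRev (hD : ∀ l, d l ≤ D) (B : ℕ)
    (h : DesignRowD (fun l => D - d (Fin.rev l)) (fun a b l => v a b (Fin.rev l)) (fun a b l => ε a b (Fin.rev l)) B) :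
    DesignRowD d v ε B := by
  have hD' : ∀ l, (fun l => D - d (Fin.rev l)) l ≤ D := fun l => Nat.sub_le _ _
  have h2 := designRowD_classRev (fun l => D - d (Fin.rev l)) D (fun a b l => v a b (Fin.rev l)) (fun a b l => ε a b (Fin.rev l)) hD' B h
  have ed : (fun l => D - (fun l => D - d (Fin.rev l)) (Fin.rev l)) = d := by
    funext l; simp only [Fin.rev_rev]; have := hD l; omega
  have ev : (fun a b l => (fun a b l => v a b (Fin.rev l)) a b (Fin.rev l)) = v := by funext a b l; simp
  have eε : (fun a b l => (fun a b l => ε a b (Fin.rev l)) a b (Fin.rev l)) = ε := by funext a b l; simp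
  rw [ed, ev, eε] at h2
  exact h2

end ClassReversal

end Summit.ValiantsHypothesis.ValiantsHypothesis.Theorems.KPlusLogSqLaw
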